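import Literature.NumberTheory.EllipticCurves.CastellaWan2024.SupersingularPConverse
import Literature.NumberTheory.EllipticCurves.BSDSelmerCMPConverseRankOneProofs
import Literature.NumberTheory.EllipticCurves.SupersingularIrreducibleProofs
import HarnessLib

/-!
# Castella–Wan, Math. Ann. 389 (2024), **Corollary B** (the mod-`p` criterion at a good supersingular
# prime of a semistable curve), PROVED relative to Theorem A along the printed proof

Sibling proof file (theorems only; no definition, no named fact — D-0014/D-0026) of
`Literature.NumberTheory.EllipticCurves.CastellaWan2024.SupersingularPConverse` (named fact
`thmA_analyticRank_eq_one_of_selmerCorank_eq_one` = Thm. A). HONEST FRAMING (cell `b2b-bsdres`,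
off-peak literature typer `b2b-bsdres-lit-cw`): research routes, no claim beyond stated classes;
nothing is asserted — every deep input is an explicit binder naming a published theorem.

Source (authors' accepted manuscript `paper:url-7157bd4f7b88` of the journal text, MS p. 2), VERBATIM:
"**Corollary B.** Let `E/ℚ` be a semistable elliptic curve, and `p > 3` a prime of good
supersingular reduction for `E`. If `Sel_p(E/ℚ) ≃ ℤ/pℤ`, then `rank_ℤ E(ℚ) = ord_{s=1} L(E, s) = 1`
and `#Ш(E/ℚ) < ∞`. *Proof.* Since `E[p]` is irreducible as a `G_{ℚ_p}`-module by a well-known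
result of Fontaine (see e.g. [Edi92]), the natural surjection `Sel_p(E/ℚ) → Sel_{p^∞}(E/ℚ)[p]` is an
isomorphism. By the exact sequence (1.1) and the non-degeneracy of the Cassels–Tate pairing on
`Ш(E/ℚ)/Ш(E/ℚ)_{div}`, we thus see that `Sel_p(E/ℚ) ≃ ℤ/pℤ ⟹ Sel_{p^∞}(E/ℚ) ≃ ℚ_p/ℤ_p`, and therefore
`ord_{s=1} L(E, s) = 1` by Theorem A. The conclusion now follows from the work of Gross–Zagier
[GZ86] and Kolyvagin [Kol88]." (Here `Sel_p(E/ℚ) ⊂ H¹(ℚ, E[p])` is "the `p`-Selmer group", MS p. 2.)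

## Transcription and proof

`Sel_p(E/ℚ) ≃ ℤ/pℤ` = `Nat.card (W.selmerGroup p) = p` (the tree's `p`-Selmer group
`WeierstrassCurve.selmerGroup`, an elementary abelian `p`-group, so "order `p`" is "`≃ ℤ/pℤ`").
The printed proof, step by step, on tree theorems:
1. "`E[p]` is irreducible" — globally: at an odd prime of good reduction with `p ∣ a_p`, `E[p]` is an
   irreducible `Γ_ℚ`-module (Serre 1972 §1.11 Prop. 12; tree THEOREM
   `hasIrreducibleModPGaloisRep_of_dvd_frobeniusTrace`), hence `E(ℚ)[p] = 0` (tree theorem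
   `natCard_torsionBy_eq_one_of_hasIrreducibleModPGaloisRep`). [The paper uses the finer local
   irreducibility (Fontaine) to get `Sel_p ≅ Sel_{p^∞}[p]` on the nose; for the corank count below
   the global statement suffices.]
2. "(1.1) and the non-degeneracy of the Cassels–Tate pairing on `Ш/Ш_div`" ⟹ `corank_{ℤ_p}
   Sel_{p^∞}(E/ℚ) = 1`: the tree theorem
   `selmerCorank_eq_one_of_card_selmerGroup_eq_of_hasIrreducibleModPGaloisRep` (the Cassels–Tate
   parity count `dim Sel_p = dim E(ℚ)[p] + corank + 2m`, `exists_selmerRank_eq_add`), granted the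
   Cassels–Tate pairing as the tree's named fact `WeierstrassCurve.exists_casselsTate_pairing`
   (Silverman *AEC* X.4.14; binder `hCT`).
3. "therefore `ord_{s=1} L(E, s) = 1` by Theorem A" — binder `h : thmA_…`.
4. "[GZ86] and Kolyvagin [Kol88]" — binder `hGZK : rank_eq_analyticRank_of_analyticRank_le_one`
   (Darmon 2004 Thm. 3.22), through the sibling's `finite_sha_of_selmerCorank_eq_one`.

## References
* [CastellaWan2023] F. Castella, X. Wan, Math. Ann. 389 (2024) 2595–2636, Cor. B and its proof
  (p. 2596; authors' MS p. 2).
* [SilvermanAEC2009] Thm. X.4.14 (Cassels–Tate); [Serre1972] §1.11 Prop. 12; [Mazur1977] p. 157;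
  [Darmon2004] Thm. 3.22; [Dokchitser2013ParityNotes] §2 (the corank count).
-/

set_option autoImplicit false

noncomputable section

open scoped Classical

open WeierstrassCurve Literature.NumberTheory.EllipticCurves
  Literature.NumberTheory.EllipticCurves.Rank1Residual

namespace Literature.NumberTheory.EllipticCurves.CastellaWan2024

/-- Step 1 of the printed proof of Cor. B, global form: at a prime `p > 3` of good supersingular
reduction, `E[p]` is an irreducible `Γ_ℚ`-module (Serre 1972 §1.11 Prop. 12, tree theorem
`hasIrreducibleModPGaloisRep_of_dvd_frobeniusTrace`: good ⇒ `p ∤ Δ_min`, supersingular ⇒ `p ∣ a_p`).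
[cite: CastellaWan2023, Cor. B (proof, p. 2596); authors' MS p. 2] [cite: Serre1972, §1.11 Prop. 12] -/
theorem irr_of_goodSS (W : WeierstrassCurve ℚ) [W.IsElliptic] [W.IsGloballyMinimal] (p : ℕ)
    [Fact p.Prime] (hp : 3 < p) (hred : GoodSS W p) : Irr W p :=
  hasIrreducibleModPGaloisRep_of_dvd_frobeniusTrace W p (by omega)
    (W.not_dvd_minimalDiscriminantInt_of_hasGoodReductionAtPrime' p hred.1) hred.2

/-- Step 2 of the printed proof of Cor. B: "`Sel_p(E/ℚ) ≃ ℤ/pℤ ⟹ Sel_{p^∞}(E/ℚ) ≃ ℚ_p/ℤ_p`" in corank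
form — at a prime `p > 3` of good supersingular reduction, `#Sel_p(E/ℚ) = p` forces
`corank_{ℤ_p} Sel_{p^∞}(E/ℚ) = 1`, by `E(ℚ)[p] = 0` (Step 1) and the Cassels–Tate parity count
(`selmerCorank_eq_one_of_card_selmerGroup_eq_of_hasIrreducibleModPGaloisRep`, granted the
Cassels–Tate pairing `hCT`, Silverman *AEC* X.4.14). Semistability is not needed for this step.
[cite: CastellaWan2023, Cor. B (proof, p. 2596); authors' MS p. 2] [cite: SilvermanAEC2009, Thm. X.4.14] -/
theorem selmerCorank_eq_one_of_card_selmerGroup_eq (hCT : exists_casselsTate_pairing (K := ℚ))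
    (W : WeierstrassCurve ℚ) [W.IsElliptic] [W.IsGloballyMinimal] (p : ℕ) [Fact p.Prime]
    (hp : 3 < p) (hred : GoodSS W p) (hSel : Nat.card (W.selmerGroup p) = p) :
    W.selmerCorank p = 1 :=
  selmerCorank_eq_one_of_card_selmerGroup_eq_of_hasIrreducibleModPGaloisRep hCT W p
    (irr_of_goodSS W p hp hred) hSel

/-- **Castella–Wan 2024, Corollary B (MS p. 2), proved relative to Theorem A.** VERBATIM: "Let `E/ℚ`
be a semistable elliptic curve, and `p > 3` a prime of good supersingular reduction for `E`. If
`Sel_p(E/ℚ) ≃ ℤ/pℤ`, then `rank_ℤ E(ℚ) = ord_{s=1} L(E, s) = 1` and `#Ш(E/ℚ) < ∞`." Granted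
Theorem A (`h`, the sibling's named fact), the Cassels–Tate pairing (`hCT`, Silverman *AEC* X.4.14 —
the printed "non-degeneracy of the Cassels–Tate pairing on `Ш/Ш_div`") and Gross–Zagier–Kolyvagin
(`hGZK`, Darmon 2004 Thm. 3.22 — the printed "[GZ86] and Kolyvagin [Kol88]"): for a globally
minimal elliptic `W/ℚ`, `3 < p`, `Semistable W`, `GoodSS W p` and `#Sel_p(E/ℚ) = p`
(`Nat.card (W.selmerGroup p) = p`, i.e. `Sel_p ≃ ℤ/pℤ`), one has `W.mordellWeilRank = 1`,
`W.analyticRank = 1` and `Ш(E/ℚ)` finite. Proof = the printed one (module docstring, Steps 1–4).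
[cite: CastellaWan2023, Cor. B and its proof (p. 2596); authors' MS p. 2]
[cite: SilvermanAEC2009, Thm. X.4.14] [cite: Darmon2004, Thm. 3.22] -/
theorem corB_rank_eq_one_of_card_selmerGroup_eq
    (h : thmA_analyticRank_eq_one_of_selmerCorank_eq_one)
    (hCT : exists_casselsTate_pairing (K := ℚ))
    (hGZK : rank_eq_analyticRank_of_analyticRank_le_one)
    (W : WeierstrassCurve ℚ) [W.IsElliptic] [W.IsGloballyMinimal] (p : ℕ) [Fact p.Prime]
    (hp : 3 < p) (hss : Semistable W) (hred : GoodSS W p)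
    (hSel : Nat.card (W.selmerGroup p) = p) :
    W.mordellWeilRank = 1 ∧ W.analyticRank = 1 ∧ Finite W.sha :=
  finite_sha_of_selmerCorank_eq_one h hGZK W p hp hss hred
    (selmerCorank_eq_one_of_card_selmerGroup_eq hCT W p hp hred hSel)

/-- **Corollary B on the cell's class X6 at `p ≥ 5`** (`ClassX6 W p = GoodSS W p ∧ Semistable W ∧ …`):
`#Sel_p(E/ℚ) = p ⟹ rank = ord = 1 ∧ #Ш < ∞`, granted Theorem A, Cassels–Tate and
Gross–Zagier–Kolyvagin. (A `p`-Selmer criterion, NOT `BSD_p`; X6 stays construction-shaped.)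
[cite: CastellaWan2023, Cor. B (p. 2596); authors' MS p. 2] -/
theorem X6.rank_eq_one_of_card_selmerGroup_eq
    (h : thmA_analyticRank_eq_one_of_selmerCorank_eq_one)
    (hCT : exists_casselsTate_pairing (K := ℚ))
    (hGZK : rank_eq_analyticRank_of_analyticRank_le_one)
    (W : WeierstrassCurve ℚ) [W.IsElliptic] [W.IsGloballyMinimal] (p : ℕ) [Fact p.Prime]
    (hp : 5 ≤ p) (hX : ClassX6 W p) (hSel : Nat.card (W.selmerGroup p) = p) :
    W.mordellWeilRank = 1 ∧ W.analyticRank = 1 ∧ Finite W.sha :=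
  corB_rank_eq_one_of_card_selmerGroup_eq h hCT hGZK W p (by omega) hX.2.1 hX.1 hSel

end Literature.NumberTheory.EllipticCurves.CastellaWan2024

end
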